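import Summits.QuantumFields.BalabanUV.Beta.CombMixedT2SiteLetter

/-!
# `BalabanUV.Beta.CombMixedT2EvenSiteLetter` — binder row D1 ∕ (C1), PART 25: **THE EVEN HALF OF THE LITERAL's DEPTH-1 SECOND-ORDER MIXED TABLE OBEYS THE
# PURE-COMMUTATOR (T2-M₂) SITE LAW — an1's per-site remainder is exactly the signed-transpose-ODD part and is KILLED by `½(K + sgnK (trK K))`; no Λ-lock,
# every level `j`: `divV (M2ᵉ_j(·; ρ′ w)) u₀ = wM2_j • (H_β ∘ D_{u₀} − D_{u₀} ∘ H_β)`, `H_β := symHessFFAt ρ_c Lc ρ′ w`, `D_{u₀} := diagK (legInd ρ_c u₀)`**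
# — the (0.4)-SYM ∕ even-half twin of road BF-x's (P-sym) `MixedWardPackingFF.divV_mixSymAt_eq_comm` in the currency of PART 19∕21 (`M2Of`, `wM2`, `sgnK ∘ trK`)

WHY (journal [AN2-G69-LANDED-3] J-NOTE-12 §3∕§3-ADD, [D1P3-G45-A2] «K2Λ WANTED», request R-AN2-69-K2L(+ADD1) `ttrl/requests.jsonl` l.4482∕4484).  Road FP's v5∕v6 second-order
H-row `hHN₂` (`FP/TowerHN2Row` v2 p587124) is a theorem modulo the lock `hcE₂`, the Wilson row (J-X₂) and ONE displayed identity (J-Λ₂) whose lv-free core (J-Λ₂′)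
factors (J-NOTE-12 §3) through the MIXED TABLE's FINE PURE-GAUGE ROW (K2b) `Σ_b (Dλ)_b • ℳ̂₂ᵉ(b,β)|ff = κ₂ • [E_λ, Ĉ″_β]`.  At the lattice level the tree had (T2-M₂) for the
PLAIN table only as «commutator + explicit remainder `R`» (`CombMixedT2SiteLetter.divV_mixedT2_site_of_lock`, `R := 2·[u₀ = root]•H − H∘D − D∘H`, with `trK R = −sgnK R`).
The table v5's right side ACTUALLY carries is the EVEN HALF `M2ᵉ := ½ • (M2 + sgnK (trK M2))` (PART 19 `WN_evenHalf_eq`, PART 21 `M2N_even_apply_inl_inl`): on it the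
remainder drops identically and the commutator survives (H antisymmetric and ff-supported, D diagonal ⇒ `[H, D]` is even, `R` odd).  This file types that, per fine site.

WHAT ([folklore] parity bookkeeping BY NAME over an1's landed site law `CombMixedT2SiteLetter.divV_symMixFFAt_site`; no `def`, no `def … : Prop`, nothing cited, 0 sorry):
§1 `divV_evenHalf` (the even half commutes with `divV`), `evenHalf_smul`, `evenHalf_siteLaw_rhs` (`½•(X + sgnK trK X) = H∘D − D∘H` for the raw right side
`X = 2·[root]•H − 2•D∘H`); §2 **`divV_mixedT2_even_site`** (displayed above, EVERY level `j`, NO `cΛ`), **`divV_mixedT2_even_site_of_lock`** (the same in `SymWardLettersAn1.hM₂_sym`'s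
letters at the Λ-lock `cΛ·Lc⁴ = 2`: `c_j • divV M2ᵉ u₀ = comp (M1Of … cΛ j ρ′ w) (diagK (½•legInd)) − comp (diagK (½•legInd)) (M1Of …)` — `divV_mixedT2_site_of_lock` WITHOUT its
remainder); §3 **`sum_mixedT2_even_sub_inl_inl`** — the `ff` entry in the period-lattice engine's `hlaw` Σ-shape: `Σ_κ (M2ᵉ κ (w₀ − e_κ) ρ′ w − M2ᵉ κ w₀ ρ′ w) x z (inl α) (inl γ)
= ([x = w₀] − [z = w₀]) · (−wM2_j · H_β x z (inl α) (inl γ))` — the fluctuation legs rotate at their sites, the contact kernel is MINUS the weighted constraint Hessian at the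
coarse bond; NO root contact, NO remainder (the sequel `CombMixedT2EvenPeriodised` periodises it: (K2b) at depth 1 on the torus).
WHAT THIS IS NOT: not the torus row; not depth ≥ 2 (the composite mixed table `compMixKer_succ` needs its own Ward induction — v5's smallest instance `n = 0` is depth 2); not
(K1′) nor the lock; nothing of Bałaban's asserted, valued or discharged; 0 estimates; 0∕4 row-D1 binders (hW, hR, D1Tel, D1Rep); ROOT M‴ p325680 ∕ P5c ∕ D6 untouched;
NOT (C1), NOT (T-ID), NOT D1, NEVER «G-an2-4 closed», NOT BetaPertH, NOT continuum, NOT Clay.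

HONEST DEPENDENCY (page 1, mandatory): continuum YM on T⁴ ⇐ BetaPertH ∧ nine spine estimates (0/9 proved); BetaPertH ⇐ (D1) ∧ (D4) ∧ CAP+tail;
G-an2-4 gates asym, D1 and NE2/3/4.  HONEST FRAMING (cell contract, verbatim): «discharging `BetaPertH` makes Bałaban's UV stability UNCONDITIONAL —
a real constructive-QFT result; it is NOT the continuum limit and NOT the Clay problem.»  ABSOLUTE RULE (cell charter, verbatim): «No internally-minted
statement may enter as a cited fact. Every hypothesis is either kernel-proved in this package or a verbatim quotation of a PUBLISHED theorem with page
reference. The manuscript(s) under audit are NOT citable for their own disputed steps — they are the thing under adjudication; programme-internal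
(2001/route/tribunal) claims are never citable.»  Row D1 ∕ (C1) OWNER an2 (b2b-balaban-beta-an2) gen 70, 2026-08-28.  No existing file touched.
-/

noncomputable section

open Finset
open scoped BigOperators
open Literature.MathematicalPhysics.QuantumFieldTheory
open Literature.MathematicalPhysics.QuantumFieldTheory.Balaban1983to89
open Literature.MathematicalPhysics.QuantumFieldTheory.Balaban1983to89.Beta
open ExpKernelCalculus (MKer comp)
open OneStepResolventKernel (Fib)
open KernelWard (divV)
open AffineAveraging (unitVec)
open AveragingContoursRooted (ctr)
open AveragingWardStencils (b6UnitVec_eq)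
open BalabanStepW2 (M2Of wM1 wM2)
open Summit.QuantumFields.BalabanUV.Beta.TameKernelCalculus (trK trK_apply)
open Summit.QuantumFields.BalabanUV.Beta.BorderedHessian (diagK stepScale stepScale_ne_zero sgnK sgnK_apply sgnF_inl sgnF_inr comp_diagK_left comp_diagK_right)
open Summit.QuantumFields.BalabanUV.Beta.AveragingWardRootedStencils (legInd legInd_inl legInd_inr)
open Summit.QuantumFields.BalabanUV.Beta.SpineRooted (M1Of M1Of_apply)
open Summit.QuantumFields.BalabanUV.Beta.WardLocusStencils (divV_apply)
open Summit.QuantumFields.BalabanUV.Beta.WardLocusParityLevels (M2Of_apply)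
open Summit.QuantumFields.BalabanUV.Beta.SymAveragingHessianCounts (symHessFFAt symHessFFAt_inl_inl symHessFFAt_inl_inr symHessFFAt_inr symHessFFAt_antisymm)
open Summit.QuantumFields.BalabanUV.Beta.SymAveragingMixedJetTables (symMixFFAt)
open Summit.QuantumFields.BalabanUV.Beta.SymWardLettersAn1 (wM2_eq)
open Summit.QuantumFields.BalabanUV.Beta.CombMixedT2SiteLetter (divV_symMixFFAt_site)

namespace Summit.QuantumFields.BalabanUV.Beta.CombMixedT2EvenSiteLetter

variable {Lc : ℕ} [NeZero Lc]

/-! ## §1 Parity bookkeeping: the even half commutes with `divV` and with scalars; the raw site law's even half is the pure commutator -/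

/-- [folklore] **THE EVEN HALF COMMUTES WITH THE PURE-GAUGE DIVERGENCE IN THE TABLE INDEX**:
`divV (κ u ↦ ½•(V κ u + sgnK (trK (V κ u)))) u₀ = ½•(divV V u₀ + sgnK (trK (divV V u₀)))` (`divV` acts on the family index, `sgnK ∘ trK` on the kernel entries). -/
theorem divV_evenHalf (V : Fin (3 + 1) → (Fin (3 + 1) → ℤ) → MKer (3 + 1) (Fib 3)) (u₀ : Fin (3 + 1) → ℤ) :
    divV (fun κ u => (1 / 2 : ℝ) • (V κ u + sgnK (trK (V κ u)))) u₀ = (1 / 2 : ℝ) • (divV V u₀ + sgnK (trK (divV V u₀))) := by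
  funext x z a b
  rw [divV_apply, Pi.smul_apply, Pi.smul_apply, Pi.smul_apply, Pi.smul_apply, smul_eq_mul, Pi.add_apply, Pi.add_apply, Pi.add_apply, Pi.add_apply,
    sgnK_apply, trK_apply, divV_apply, divV_apply, Finset.mul_sum, mul_add, Finset.mul_sum, Finset.mul_sum, ← Finset.sum_add_distrib]
  refine Finset.sum_congr rfl fun κ _ => ?_
  simp only [Pi.smul_apply, Pi.add_apply, smul_eq_mul, sgnK_apply, trK_apply]
  ring

/-- [folklore] the even half is homogeneous: `½•(c•X + sgnK (trK (c•X))) = c • ½•(X + sgnK (trK X))`. -/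
theorem evenHalf_smul (c : ℝ) (X : MKer (3 + 1) (Fib 3)) :
    (1 / 2 : ℝ) • (c • X + sgnK (trK (c • X))) = c • ((1 / 2 : ℝ) • (X + sgnK (trK X))) := by
  funext x z a b
  simp only [Pi.smul_apply, Pi.add_apply, smul_eq_mul, sgnK_apply, trK_apply]
  ring

omit [NeZero Lc] in
/-- [folklore] **THE EVEN HALF OF THE RAW SITE LAW's RIGHT SIDE IS THE PURE COMMUTATOR** (`H := symHessFFAt ρ_c Lc ρ′ w` is antisymmetric — `symHessFFAt_antisymm` — and
field–field supported, `D := diagK (legInd ρ_c u₀)` is diagonal): `½•(X + sgnK (trK X)) = comp H D − comp D H` for `X := (2·[u₀ = Lc•w + ρ_c])•H − 2•comp D H`; equivalently the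
remainder `R = X − (H∘D − D∘H)` of `CombMixedT2SiteLetter` is the odd half (`trK_remainder`). -/
theorem evenHalf_siteLaw_rhs (ρ' : Fin 4) (w u₀ : Fin 4 → ℤ) :
    (1 / 2 : ℝ) • (((2 * (if u₀ = (Lc : ℤ) • w + ctr 4 Lc then (1 : ℝ) else 0)) • symHessFFAt (ctr 4 Lc) Lc ρ' w
          - (2 : ℝ) • comp (diagK (legInd (ctr 4 Lc) u₀)) (symHessFFAt (ctr 4 Lc) Lc ρ' w))
        + sgnK (trK ((2 * (if u₀ = (Lc : ℤ) • w + ctr 4 Lc then (1 : ℝ) else 0)) • symHessFFAt (ctr 4 Lc) Lc ρ' w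
          - (2 : ℝ) • comp (diagK (legInd (ctr 4 Lc) u₀)) (symHessFFAt (ctr 4 Lc) Lc ρ' w))))
      = comp (symHessFFAt (ctr 4 Lc) Lc ρ' w) (diagK (legInd (ctr 4 Lc) u₀))
          - comp (diagK (legInd (ctr 4 Lc) u₀)) (symHessFFAt (ctr 4 Lc) Lc ρ' w) := by
  funext x z a b
  simp only [Pi.smul_apply, Pi.add_apply, Pi.sub_apply, smul_eq_mul, sgnK_apply, trK_apply, comp_diagK_left, comp_diagK_right]
  rw [symHessFFAt_antisymm (ctr 4 Lc) Lc ρ' w x z a b]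
  rcases a with α | m <;> rcases b with β | m'
  · rw [sgnF_inl, sgnF_inl, legInd_inl, legInd_inl]
    ring
  · rw [symHessFFAt_inl_inr]
    ring
  · rw [symHessFFAt_inr]
    ring
  · rw [symHessFFAt_inr]
    ring

/-! ## §2 (T2-M₂) for the EVEN HALF of the literal's depth-1 mixed table: pure commutator, every level, no Λ-lock -/

/-- [folklore] **`divV_mixedT2_even_site` — THE EVEN HALF OF `M2Of 3 Lc (symMixFFAt ρ_c Lc) j` OBEYS THE PURE-COMMUTATOR SITE LAW** (every level `j`, every multiplier
bond `(ρ′, w)`, every fine site `u₀`; NO `cΛ`, NO remainder): with `M2ᵉ κ u := ½•(M2Of … j κ u ρ′ w + sgnK (trK (M2Of … j κ u ρ′ w)))`,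
`divV M2ᵉ u₀ = wM2_j • (comp H_β D_{u₀} − comp D_{u₀} H_β)`, `H_β := symHessFFAt ρ_c Lc ρ′ w`, `D_{u₀} := diagK (legInd ρ_c u₀)` — an1's raw site law
`divV_symMixFFAt_site` (`2·[u₀ = root]•H − 2•D∘H`), weighted by `wM2_j` (`M2Of_apply`), its even half taken (§1). -/
theorem divV_mixedT2_even_site (j : ℕ) (ρ' : Fin 4) (w u₀ : Fin 4 → ℤ) :
    divV (fun κ u => (1 / 2 : ℝ) • (M2Of 3 Lc (symMixFFAt (ctr 4 Lc) Lc) j κ u ρ' w + sgnK (trK (M2Of 3 Lc (symMixFFAt (ctr 4 Lc) Lc) j κ u ρ' w)))) u₀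
      = wM2 3 Lc j • (comp (symHessFFAt (ctr 4 Lc) Lc ρ' w) (diagK (legInd (ctr 4 Lc) u₀))
          - comp (diagK (legInd (ctr 4 Lc) u₀)) (symHessFFAt (ctr 4 Lc) Lc ρ' w)) := by
  rw [divV_evenHalf]
  have hdiv : divV (fun κ u => M2Of 3 Lc (symMixFFAt (ctr 4 Lc) Lc) j κ u ρ' w) u₀ = wM2 3 Lc j • divV (fun κ u => symMixFFAt (ctr 4 Lc) Lc κ u ρ' w) u₀ := by
    funext x z a b
    rw [divV_apply, Pi.smul_apply, Pi.smul_apply, Pi.smul_apply, Pi.smul_apply, smul_eq_mul, divV_apply, Finset.mul_sum]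
    refine Finset.sum_congr rfl fun κ _ => ?_
    simp only [M2Of_apply, Pi.smul_apply, smul_eq_mul, mul_sub]
  rw [hdiv, divV_symMixFFAt_site, evenHalf_smul, evenHalf_siteLaw_rhs]

/-- [folklore] **`divV_mixedT2_even_site_of_lock` — THE SAME IN `SymWardLettersAn1.hM₂_sym`'s LETTERS AT THE Λ-LOCK** (`cΛ·Lc⁴ = 2`, `c_j = (stepScale_j·Lc⁴)⁻¹`, multiplier table
`M1Of 3 Lc (symHessFFAt ρ_c Lc) cΛ j`, generator `½•legInd ρ_c u₀`): `c_j • divV M2ᵉ u₀ = comp (M1Of … cΛ j ρ′ w) (diagK (½•legInd ρ_c u₀)) − comp (diagK (½•legInd ρ_c u₀)) (M1Of … cΛ j ρ′ w)`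
— `CombMixedT2SiteLetter.divV_mixedT2_site_of_lock` with its remainder `(wM1_j∕Lc⁴)•R` GONE. -/
theorem divV_mixedT2_even_site_of_lock {cΛ : ℝ} (hΛ : cΛ * (Lc : ℝ) ^ 4 = 2) (j : ℕ) (ρ' : Fin 4) (w u₀ : Fin 4 → ℤ) :
    (stepScale 3 Lc j * (Lc : ℝ) ^ (3 + 1))⁻¹ •
        divV (fun κ u => (1 / 2 : ℝ) • (M2Of 3 Lc (symMixFFAt (ctr 4 Lc) Lc) j κ u ρ' w + sgnK (trK (M2Of 3 Lc (symMixFFAt (ctr 4 Lc) Lc) j κ u ρ' w)))) u₀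
      = comp (M1Of 3 Lc (symHessFFAt (ctr 4 Lc) Lc) cΛ j ρ' w) (diagK ((1 / 2 : ℝ) • legInd (ctr 4 Lc) u₀))
          - comp (diagK ((1 / 2 : ℝ) • legInd (ctr 4 Lc) u₀)) (M1Of 3 Lc (symHessFFAt (ctr 4 Lc) Lc) cΛ j ρ' w) := by
  have hL : (Lc : ℝ) ≠ 0 := Nat.cast_ne_zero.2 (NeZero.ne Lc)
  have hs : stepScale 3 Lc j ≠ 0 := stepScale_ne_zero j
  have hc : cΛ = 2 / (Lc : ℝ) ^ 4 := by
    rw [eq_div_iff (pow_ne_zero _ hL)]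
    exact hΛ
  rw [divV_mixedT2_even_site]
  funext x z a b
  simp only [Pi.smul_apply, Pi.sub_apply, smul_eq_mul, comp_diagK_left, comp_diagK_right, M1Of_apply, hc, wM2_eq]
  rw [show (3 + 1 : ℕ) = 4 from rfl]
  field_simp

/-! ## §3 The `ff` entry in the period-lattice engine's `hlaw` shape -/

/-- [folklore] **`sum_mixedT2_even_sub_inl_inl` — (T2-M₂)ᵉ IN Σ-FORM ON THE `(inl, inl)` BLOCK** (the shape of `CombWilsonT2Periodised.sum_tgrad_mul_perZ_dper_of_indexLaw_periodCov`'s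
`hlaw`, and of leaf-02's `PeriodisedSymBorderT2IndexWard.sum_symVh₂SAn1_sub_inr_inl`): for every level `j`, multiplier bond `(ρ′, w)`, site `w₀` and `ff` entry,
`Σ_κ (M2ᵉ κ (w₀ − e_κ) ρ′ w − M2ᵉ κ w₀ ρ′ w) x z (inl α) (inl γ) = ([x = w₀] − [z = w₀]) · (−(wM2_j · symHessFFAt ρ_c Lc ρ′ w x z (inl α) (inl γ)))` — both fluctuation legs rotate
at their own sites; the contact kernel is MINUS the weighted constraint Hessian of the coarse bond; NO root contact, NO remainder. -/
theorem sum_mixedT2_even_sub_inl_inl (j : ℕ) (ρ' : Fin 4) (w w₀ x z : Fin 4 → ℤ) (α γ : Fin 4) :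
    ∑ κ : Fin 4, (((1 / 2 : ℝ) • (M2Of 3 Lc (symMixFFAt (ctr 4 Lc) Lc) j κ (w₀ - unitVec κ) ρ' w
          + sgnK (trK (M2Of 3 Lc (symMixFFAt (ctr 4 Lc) Lc) j κ (w₀ - unitVec κ) ρ' w)))) x z (Sum.inl α) (Sum.inl γ)
        - ((1 / 2 : ℝ) • (M2Of 3 Lc (symMixFFAt (ctr 4 Lc) Lc) j κ w₀ ρ' w
          + sgnK (trK (M2Of 3 Lc (symMixFFAt (ctr 4 Lc) Lc) j κ w₀ ρ' w)))) x z (Sum.inl α) (Sum.inl γ))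
      = ((if x = w₀ then (1 : ℝ) else 0) - (if z = w₀ then 1 else 0))
          * (-(wM2 3 Lc j * symHessFFAt (ctr 4 Lc) Lc ρ' w x z (Sum.inl α) (Sum.inl γ))) := by
  have h := congrFun (congrFun (congrFun (congrFun (divV_mixedT2_even_site (Lc := Lc) j ρ' w w₀) x) z) (Sum.inl α)) (Sum.inl γ)
  rw [divV_apply] at h
  simp only [b6UnitVec_eq] at h
  rw [h, Pi.smul_apply, Pi.smul_apply, Pi.smul_apply, Pi.smul_apply, smul_eq_mul, Pi.sub_apply, Pi.sub_apply, Pi.sub_apply, Pi.sub_apply,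
    comp_diagK_right, comp_diagK_left, legInd_inl, legInd_inl]
  ring

end Summit.QuantumFields.BalabanUV.Beta.CombMixedT2EvenSiteLetter

end
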